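import Summits.HodgeConjecture.HodgeConjecture.Theorems.Q8SymplecticPowersRegularOfDoublePlane
import Literature.AlgebraicGeometry.HodgeTheory.QuaternionicQuarticDoublePlaneIntegral
import Literature.AlgebraicGeometry.Surfaces.HirzebruchTwoNodalDoubleCover
import HarnessLib

/-!
# Route `Q8SymplecticPowers`, crux K1Q (stmt-HodgeConjecture-24190), line `mechanism-v2`: stub S1 `stub_regularVeryGeneralQ`
# FROM THE PRINT FACT S1b «double covers of 𝔽₂ with nodal branch curve are regular» + CHART-WISE NODALITY ON A DENSE SET

Helper file (`--supports stmt-HodgeConjecture-24190`; nothing here closes an item). Sorry-free; axioms standard; no definition;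
ONE named fact taken as a hypothesis (`Literature.AlgebraicGeometry.Surfaces.HirzebruchTwoDoublePlane.hirzebruchTwo_nodalDoubleCover_bettiOne_eq_zero`,
p828133, [BarthPetersVandeVen1984 V §22 + III §7, IV §2; Hartshorne V.2]). Written by the prover seat
`leafhand-hodge-q8symplecticpowers-4` (g5, ninth hand).

This is the ASSEMBLY step of the S1 re-cut proposed in memo NINTH-HAND-S1-DESIGN-leafhand4-g5: it isolates the remaining
algebra of S1 as ONE hypothesis `hNod` — for every even `e ≥ 4` and every `0 ≠ g ∈ ℂ[a]`, some parameter `a` with `g(a) ≠ 0`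
whose branch form `G₂ = planeG₂ a (a₀² − a₁²)⁻¹ = s·A₂·Ψ₂ ∈ ℂ[s, y]` (p826717; the double plane is `t² = G₂`, Zariski's
`z² = f(x,y)`) has exact `y`-degree `α` (even, `≥ 2`) and exact `N`, and is NODAL in the four charts of `𝔽₂`
(`AffineNodalCurves.IsNodal`, with the fibre `f_∞` thrown in when `N` is odd) — and proves

  S1b ∧ hNod ⟹ S1 VERBATIM,

through the tree's (Z_b) reduction `Q8SymplecticPowersRegularOfDenseBettiRegularMembers` (p798088), the desingularisation
`Q8SymplecticPowersRegularOfDesingularization.exists_desingularization_fiberSch`, the double-plane bridge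
`Q8SymplecticPowersRegularOfDoublePlane.birationalOver_fiberSch_doublePlane` (p827228), the plane coordinates
`Q8Family.doublePlaneRingEquivPlane` (p826424) and the identification `PlaneDoubleRing a d = ℂ[s,y,t]/(t² − G₂)`
(`span_planeRel_eq`, from `toPolyEquiv_planeRel`, p826717). For the route: `α = e`, `N = 1` (memo §3).

* `toPolyEquiv_rename_castSucc`, `planeRel_eq_X_sq_sub_rename`, `span_planeRel_eq` — `planeRel = t² − G₂(s, y)` on the nose;
* `birationalOver_spec_of_algEquiv` — a `ℂ`-algebra isomorphism makes the spectra birational over `ℂ`;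
* `stub_regularVeryGeneralQ_of_nodalDoubleCoverFact` — **S1 VERBATIM from S1b and `hNod`**.

Honest scope: a conditional reduction; S1, K1Q, HC are NOT proved here; S1b is a named (unproved) print fact.
-/

set_option linter.dupNamespace false
set_option maxHeartbeats 400000

noncomputable section

open CategoryTheory AlgebraicGeometry MvPolynomial
open Literature.AlgebraicGeometry Literature.AlgebraicGeometry.Motives Literature.AlgebraicGeometry.HodgeTheory
open Literature.AlgebraicGeometry.HodgeTheory.BettiUniverse Literature.AlgebraicGeometry.HodgeTheory.Q8Family
open Literature.AlgebraicGeometry.PlaneCurves.AffineNodalCurves Literature.AlgebraicGeometry.Surfaces.HirzebruchTwoDoublePlane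

namespace Summit.HodgeConjecture.HodgeConjecture.Theorems.Q8SymplecticPowersRegularOfNodalBranchCurve

universe v

/-- `toPolyEquiv` sends a polynomial in `s, y` (embedded into `R[s, y, t]`) to the constant polynomial `C G ∈ (R[s,y])[T]`.
[cite: AtiyahMacdonald1969, Ch. 1 Ex. 2–4 (polynomial rings in several variables)] -/
theorem toPolyEquiv_rename_castSucc {R : Type v} [CommRing R] (G : MvPolynomial (Fin 2) R) :
    toPolyEquiv R (rename Fin.castSucc G) = Polynomial.C G := by
  have h : (toPolyEquiv R).toAlgHom.comp (rename Fin.castSucc) =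
      (Polynomial.CAlgHom : MvPolynomial (Fin 2) R →ₐ[R] Polynomial (MvPolynomial (Fin 2) R)) := by
    refine MvPolynomial.algHom_ext fun i => ?_
    fin_cases i
    · simp [toPolyEquiv_X0, Polynomial.CAlgHom]
    · simp [toPolyEquiv_X1, Polynomial.CAlgHom]
  exact DFunLike.congr_fun h G

/-- **The double-plane relation is `t² − G₂(s, y)` on the nose**: `planeRel a d = X 2 ^ 2 − G₂` with `G₂ = planeG₂ a d`
embedded into `R[s, y, t]`. [cite: Zariski1929] [cite: Naie2007, §1.2 (normalization procedure) and Example 1] -/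
theorem planeRel_eq_X_sq_sub_rename {R : Type v} [CommRing R] {e : ℕ} (a : CIdx e → R) (d : R) :
    planeRel a d = X 2 ^ 2 - rename Fin.castSucc (planeG₂ a d) := by
  apply (toPolyEquiv R).injective
  rw [toPolyEquiv_planeRel, map_sub, map_pow, toPolyEquiv_X2, toPolyEquiv_rename_castSucc]
  rfl

/-- Hence the ideals agree: `(planeRel) = (t² − G₂)`. [cite: Zariski1929] -/
theorem span_planeRel_eq {R : Type v} [CommRing R] {e : ℕ} (a : CIdx e → R) (d : R) :
    Ideal.span {planeRel a d} = Ideal.span {(X 2 ^ 2 - rename Fin.castSucc (planeG₂ a d) : MvPolynomial (Fin 3) R)} := by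
  rw [planeRel_eq_X_sq_sub_rename]

/-- A `ℂ`-algebra isomorphism `A ≃ₐ[ℂ] B` makes `Spec B` and `Spec A` birational over `Spec ℂ` (the induced isomorphism of
`ℂ`-schemes is a dominant open immersion). [cite: GortzWedhorn2020, Prop. 4.32 (2)] -/
theorem birationalOver_spec_of_algEquiv {A B : Type} [CommRing A] [CommRing B] [Algebra ℂ A] [Algebra ℂ B]
    (φ : A ≃ₐ[ℂ] B) :
    Scheme.BirationalOver (Spec.map (CommRingCat.ofHom (algebraMap ℂ B)))
      (Spec.map (CommRingCat.ofHom (algebraMap ℂ A))) := by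
  haveI : IsIso (CommRingCat.ofHom φ.toRingEquiv.toRingHom) :=
    (inferInstance : IsIso φ.toRingEquiv.toCommRingCatIso.hom)
  refine Scheme.Hom.birationalOver (Spec.map (CommRingCat.ofHom φ.toRingEquiv.toRingHom)) _ _ ?_
  rw [← Spec.map_comp, ← CommRingCat.ofHom_comp]
  congr 2
  ext x
  exact φ.commutes x

/-- **S1 VERBATIM from the print fact S1b and chart-wise nodality on a dense parameter set.** Granted
`hS1b` = `hirzebruchTwo_nodalDoubleCover_bettiOne_eq_zero` (double covers of `𝔽₂` with nodal branch curve are regular,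
[BarthPetersVandeVen1984 V §22 + III §7, IV §2; Hartshorne V.2]) and `hNod` = «for every even `e ≥ 4` and every `0 ≠ g ∈ ℂ[a]`
some `a` with `g(a) ≠ 0` has a branch form `G₂ = planeG₂ a (a₀² − a₁²)⁻¹` with exact data `(α, N)`, `α` even `≥ 2`, nodal in the
four charts of `𝔽₂`», the registered statement of S1 holds: very generally every smooth projective surface birational to
`V_(c,ψ)` has `b₁ = 0`. [cite: BarthPetersVandeVen1984, V §22 (invariants of double coverings)] [cite: Zariski1929]
[cite: Naie2007, Thm. 1] [cite: VoisinHodgeI2002, §9.1.1 Thm. 9.3] -/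
theorem stub_regularVeryGeneralQ_of_nodalDoubleCoverFact
    (hS1b : hirzebruchTwo_nodalDoubleCover_bettiOne_eq_zero)
    (hNod : ∀ ⦃e : ℕ⦄, Even e → 4 ≤ e → ∀ g : ParamRing e, g ≠ 0 → ∃ a : CIdx e → ℂ, MvPolynomial.eval a g ≠ 0 ∧
      ∃ α N : ℕ, Even α ∧ 2 ≤ α ∧
        IsChartExact α N (planeG₂ a (coefLin a 0 ^ 2 - coefLin a 1 ^ 2)⁻¹) ∧
        IsNodal (planeG₂ a (coefLin a 0 ^ 2 - coefLin a 1 ^ 2)⁻¹) ∧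
        IsNodal (X 0 ^ (N % 2) * chartTwo N (planeG₂ a (coefLin a 0 ^ 2 - coefLin a 1 ^ 2)⁻¹)) ∧
        IsNodal (chartThree α (planeG₂ a (coefLin a 0 ^ 2 - coefLin a 1 ^ 2)⁻¹)) ∧
        IsNodal (X 0 ^ (N % 2) * chartFour α N (planeG₂ a (coefLin a 0 ^ 2 - coefLin a 1 ^ 2)⁻¹))) :
open Literature.AlgebraicGeometry.Motives Literature.AlgebraicGeometry.HodgeTheory Literature.AlgebraicGeometry.HodgeTheory.BettiUniverse CategoryTheory.Limits in ∀ ⦃e : ℕ⦄, Even e → 4 ≤ e → ∃ G : ℕ → MvPolynomial ({d : Fin 3 →₀ ℕ // d.degree = 1} ⊕ {d : Fin 3 →₀ ℕ // d.degree = e - 1}) ℂ, (∀ i, ∃ c ψ : MvPolynomial (Fin 3) ℂ, c.IsHomogeneous 1 ∧ ψ.IsHomogeneous (e - 1) ∧ MvPolynomial.rename (Equiv.swap (0 : Fin 3) 1) ψ = ψ ∧ MvPolynomial.eval (Sum.elim (fun d => c.coeff d.1) (fun d => ψ.coeff d.1)) (G i) ≠ 0) ∧ ∀ c ψ : MvPolynomial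 (Fin 3) ℂ, c.IsHomogeneous 1 → ψ.IsHomogeneous (e - 1) → MvPolynomial.rename (Equiv.swap (0 : Fin 3) 1) ψ = ψ → (∀ i, MvPolynomial.eval (Sum.elim (fun d => c.coeff d.1) (fun d => ψ.coeff d.1)) (G i) ≠ 0) → ∀ ⦃V X : SchemeOver ℂ⦄ (hX : IsSmoothProjective 2 X), IsHypersurfaceCutOutBy 3 (MvPolynomial.X (Fin.last 3) ^ 4 * MvPolynomial.X (Fin.castSucc 2) ^ (2 * e) - MvPolynomial.rename Fin.castSucc (c * MvPolynomial.rename (Equiv.swap (0 : Fin 3) 1) c ^ 3 * ((MvPolynomial.X 0 - MvPolynomial.X 1) * ψ) ^ 2)) V → AlgebraicGeometry.Scheme.BirationalOver X.hom V.hom → Module.finrank ℚ (bettiCohomology X 1) = 0 := by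
  refine Q8SymplecticPowersRegularOfDenseBettiRegularMembers.stub_regularVeryGeneralQ_of_dense_bettiRegularMembers
    fun e he h4 g hg => ?_
  have he2 : 2 ≤ e := le_trans (by norm_num) h4
  have hg' : g * doublePlaneGenericityElem e ≠ 0 := mul_ne_zero hg (doublePlaneGenericityElem_ne_zero e he2)
  obtain ⟨a, hga', α, N, hα, h2α, hex, hn1, hn2, hn3, hn4⟩ := hNod he h4 _ hg'
  rw [map_mul, mul_ne_zero_iff] at hga'
  obtain ⟨hga, hg0⟩ := hga'
  have ha : (fun i => (MvPolynomial.eval a) (MvPolynomial.X i : ParamRing e)) = a := funext fun i => MvPolynomial.eval_X _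
  obtain ⟨hG, hdet, hψ⟩ := genericity_of_eval_ne_zero (MvPolynomial.eval a) hg0
  have hdet' : coefLin a 0 ^ 2 - coefLin a 1 ^ 2 ≠ 0 := by rw [← ha]; exact hdet
  have hψ' : ψ₂ a ≠ 0 := by rw [← ha]; exact hψ
  -- a smooth projective model of the quartic fibre
  obtain ⟨-, X₀, π, hX₀, hπ⟩ := Q8SymplecticPowersRegularOfDesingularization.exists_desingularization_fiberSch he2 a hG
  have hbirV : Scheme.BirationalOver X₀.hom (fiberSch e (MvPolynomial.eval a)).hom :=
    Q8SymplecticPowersRegularOfDesingularization.birationalOver_of_isBirational π hπ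
  -- the chain: quartic fibre ~ double-plane chart ~ plane coordinates = affine double plane `t² = G₂`
  have hNT : Nontrivial (DeckRing a) := nontrivial_deckRing_of_field a hdet' hψ'
  have h1 := Q8SymplecticPowersRegularOfDoublePlane.birationalOver_fiberSch_doublePlane he2 a hG hNT hdet' hψ'
  set d : ℂ := (coefLin a 0 ^ 2 - coefLin a 1 ^ 2)⁻¹ with hd_def
  have hd : (coefLin a 0 ^ 2 - coefLin a 1 ^ 2) * d = 1 := mul_inv_cancel₀ hdet'
  have h2 : Scheme.BirationalOver (Spec.map (CommRingCat.ofHom (algebraMap ℂ (PlaneDoubleRing a d))))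
      (Spec.map (CommRingCat.ofHom (algebraMap ℂ (DoublePlaneRing a)))) :=
    birationalOver_spec_of_algEquiv (doublePlaneRingEquivPlane a d hd)
  have h3 : Scheme.BirationalOver (Spec.map (CommRingCat.ofHom (algebraMap ℂ (DoublePlaneAffineRing (planeG₂ a d)))))
      (Spec.map (CommRingCat.ofHom (algebraMap ℂ (PlaneDoubleRing a d)))) :=
    birationalOver_spec_of_algEquiv (Ideal.quotientEquivAlgOfEq ℂ (span_planeRel_eq a d))
  have hbX : Scheme.BirationalOver X₀.hom
      (Spec.map (CommRingCat.ofHom (algebraMap ℂ (DoublePlaneAffineRing (planeG₂ a d))))) :=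
    hbirV.trans (h1.symm.trans (h2.symm.trans h3.symm))
  have hb : Module.finrank ℚ (bettiCohomology X₀ 1) = 0 := hS1b _ α N hα h2α hex hn1 hn2 hn3 hn4 X₀ hX₀ hbX
  exact ⟨a, hga, hG, X₀, hX₀, hbirV, hb⟩

end Summit.HodgeConjecture.HodgeConjecture.Theorems.Q8SymplecticPowersRegularOfNodalBranchCurve

end
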